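import Summits.BirchSwinnertonDyer.BirchSwinnertonDyer.Theorems.KolyvaginDepthDoorDepthTableRowKitPrint
import Summits.BirchSwinnertonDyer.BirchSwinnertonDyer.Theorems.KolyvaginDepthDoorDepthTableRowsOfPrint5
import Summits.BirchSwinnertonDyer.BirchSwinnertonDyer.Theorems.KolyvaginDepthDoorDepthTableRowsOfPrint6
import HarnessLib

/-!
# Route `KolyvaginDepthDoor` — DEPTH-TABLE rows `997c1` `(5, -67, 229)`, `664a1` `(5, -39, 29)`, `916c1` `(5, -111, 19)`, `944e1` `(5, -31, 239)`
# ON PRINT-STANDARD INPUTS: no McCallum leaf, no structure theorem, no twist point, no system — the bit at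
# ANY datum, (γ) [Gross 1991 Prop. 3.7 (2)] the only named input (+ F1 = [GZ86 III (3.1)] for `944e1`, off the Kodaira–Néron cell) (crux `KolyvaginDepthSupply`,
# stmt-BirchSwinnertonDyer-21765) — part 4 of 4

Helper file (`--supports stmt-BirchSwinnertonDyer-21765 --as helper`); it closes nothing and BSD is
not proved by it.

g7's rows `C<label>.depthRow_<p>_neg<D>_<ℓ>_ofDatum` (files `…DepthTableRowsNoTwistOfDatum*`) read each row
off the kit OF A DATUM modulo FIVE named McCallum / Gross leaves (`h54 h43 h44 h53 h22`). This file
re-issues the same rows over the kit ON PRINT-STANDARD INPUTS `depthRow_print_of_datum_of_intModel_certificate`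
(file `…DepthTableRowKitPrint`): the sign law (Gross 5.4), McCallum's Lemma 5.3 and Prop. 2.2 are now
tree THEOREMS at level `p` (`…LeafSign`, `…LeafEigenLine`, `…LeafReciprocity`); Lemma 4.3 is PROVED on
the Kodaira–Néron cell (`…LeafLocal`, x11b3's ENDs), and the (KN_p) side condition of each row is
CERTIFIED IN THE KERNEL from the discriminant of its integer model (a `decide`-able table); Prop. 4.4
comes from the ONE remaining named input (γ) = `GrossLMS1991.prop37_2_frobeniusCongruence` (Gross 1991
Prop. 3.7 (2), cite-only) through `JET.prop44_of_frobeniusCongruence`. Each row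
`C<label>.depthRow_<p>_neg<D>_<ℓ>_print` takes ANY single datum `d : KolyvaginHeegnerData Dt β ι ℓ`
and its bit and concludes `corank_{ℤ_p} Ш(E)[p^∞] = 0`, `rank_ℤ E(ℚ) = 2`, `rank_ℤ E^{(D)}(ℚ) ≤ 1`,
`E(ℚ)[p] = 0`, `Ш(E/ℚ)[p] = 0`, `#Sel^(p)(E/ℚ) = p²`. CONDITIONAL on (γ) (+ F1 for `944e1`) and the bit;
per-curve; BSD is not proved by it.
-/

set_option linter.dupNamespace false

noncomputable section

open scoped Classical NumberField

namespace Summit.BirchSwinnertonDyer.BirchSwinnertonDyer.Theorems.KolyvaginDepthDoor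

open Literature.NumberTheory.EllipticCurves Literature.NumberTheory.EllipticCurves.ModularForms
  Literature.NumberTheory.EllipticCurves.McCallum1991 WeierstrassCurve
open Summit.BirchSwinnertonDyer.BirchSwinnertonDyer.Rank2Observatory
open Summit.BirchSwinnertonDyer.BirchSwinnertonDyer.Rank1Residual

namespace C997c1

/-- **DEPTH-TABLE ROW`997c1`, `(p, d_K, ℓ) = (5, -67, 229)`, ON PRINT-STANDARD INPUTS — no McCallum
leaf, no structure theorem, no twist point, no system (bit at ANY datum).** For `E = 997c1`, ANY
imaginary quadratic `K` with `d_K = -67`, any frame `(Dt, β, ι)` and ANY single Kolyvagin–Heegner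
datum `d` of conductor `229`, granted the ONE Literature fact (γ) =
`GrossLMS1991.prop37_2_frobeniusCongruence` (Gross 1991 Prop. 3.7 (2), the Eichler–Shimura
congruence for Heegner points; cite-only): IF `d.kolyvaginClass _ 1 ≠ 0` (the row's bit), THEN
`corank_{ℤ_5} Ш(E)[5^∞] = 0`, `rank_ℤ E(ℚ) = 2`, `rank_ℤ E^{(-67)}(ℚ) ≤ 1`, `E(ℚ)[5] = 0`,
`Ш(E/ℚ)[5] = 0` and `#Sel^(5)(E/ℚ) = 5²` — the twin of `C997c1.depthRow_5_neg67_229_ofDatum` with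
its FIVE named McCallum / Gross leaves (`h54 h43 h44 h53 h22`) DELETED: the sign law, Lemma 5.3 and
Prop. 2.2 are tree theorems (`…LeafSign`, `…LeafEigenLine`, `…LeafReciprocity`), Lemma 4.3 is proved
on the Kodaira–Néron cell / taken from F1 (`…LeafLocal`), Prop. 4.4 comes from (γ)
(`JET.prop44_of_frobeniusCongruence`); the Kodaira–Néron side condition (KN_5) `5 ∤ ord_v(Δ_min)` at
the multiplicative places is CERTIFIED IN THE KERNEL from `Δ(E₀) = 997` (`decide`-able table of
`depthRow_print_of_datum_of_intModel_certificate`), the additive clause is void (`5 ≠ 3`). Every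
other side condition is a kernel theorem of the tree (g2–g7 certificates). CONDITIONAL on (γ) and
the bit; per-curve; BSD is not proved by it. [cite: Kolyvagin1991MathAnn, Thm. 2.3] [cite:
GrossLMS1991, Prop. 3.7 (2), §5 (5.1), Prop. 6.2 (1)] [cite: McCallumLMS1991, §§2–5] [cite:
JetchevLauterStein2009, §3.6 (arXiv:0707.0032)] -/
theorem depthRow_5_neg67_229_print
    (h372 : GrossLMS1991.prop37_2_frobeniusCongruence)
    (K : Type) [Field K] [NumberField K] (hK : IsImaginaryQuadratic K)
    (hD : NumberField.discr K = -67) :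
    haveI := isElliptic_c997c1;
    haveI := isGloballyMinimal_c997c1;
    haveI : NeZero (((⟨0, -1, 1, -24, 54⟩ : WeierstrassCurve ℤ).map (Int.castRingHom ℚ)).conductorNorm ℤ) :=
      neZero_conductorNorm_of_isElliptic _;
    ∀ (Dt : ModularParametrizationData ((⟨0, -1, 1, -24, 54⟩ : WeierstrassCurve ℤ).map (Int.castRingHom ℚ))
        (((⟨0, -1, 1, -24, 54⟩ : WeierstrassCurve ℤ).map (Int.castRingHom ℚ)).conductorNorm ℤ)) (β : ℤ)
      (ι : K →+* ℂ) (d : KolyvaginHeegnerData Dt β ι 229),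
    d.kolyvaginClass (p := 5) (by norm_num) 1 ≠ 0 →
    ((⟨0, -1, 1, -24, 54⟩ : WeierstrassCurve ℤ).map (Int.castRingHom ℚ)).shaCorank 5 = 0 ∧
      ((⟨0, -1, 1, -24, 54⟩ : WeierstrassCurve ℤ).map (Int.castRingHom ℚ)).mordellWeilRank = 2 ∧
      (((⟨0, -1, 1, -24, 54⟩ : WeierstrassCurve ℤ).map (Int.castRingHom ℚ)).quadraticTwist
        ((-67 : ℤ) : ℚ)).mordellWeilRank ≤ 1 ∧
      (∀ P : ((⟨0, -1, 1, -24, 54⟩ : WeierstrassCurve ℤ).map (Int.castRingHom ℚ)).toAffine.Point,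
        5 • P = 0 → P = 0) ∧
      (∀ x ∈ ((⟨0, -1, 1, -24, 54⟩ : WeierstrassCurve ℤ).map (Int.castRingHom ℚ)).sha, 5 • x = 0 → x = 0) ∧
      Nat.card ↥(selmerGroup ((⟨0, -1, 1, -24, 54⟩ : WeierstrassCurve ℤ).map (Int.castRingHom ℚ))
        ((5 : ℕ) : ℤ)) = 5 ^ 2 := by
  haveI := isElliptic_c997c1
  haveI := isGloballyMinimal_c997c1
  haveI : NeZero (((⟨0, -1, 1, -24, 54⟩ : WeierstrassCurve ℤ).map (Int.castRingHom ℚ)).conductorNorm ℤ) :=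
    neZero_conductorNorm_of_isElliptic _
  intro Dt β ι d hne
  haveI := Fact.mk (by norm_num : Nat.Prime 5)
  exact depthRow_print_of_datum_of_intModel_certificate intModel h372 not_hasCM
    KernelCerts003.C997c1.two_le_rank 5 (by norm_num) hasSurjectiveModNGaloisRep_pow_5 K hK hD
    (by norm_num) (by norm_num) heegner_neg67 229 (by norm_num) (by norm_num) (by decide +kernel)
    (by norm_num) (by norm_num) (by norm_num) (by norm_num) (n := 255) card_229 (by norm_num)
    (Δ₀ := 997) (by decide +kernel) (B := 11) (by decide +kernel) (by decide +kernel)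
    (fun _ _ ↦ Or.inl (by norm_num)) Dt β ι d hne

end C997c1

namespace C664a1

/-- **DEPTH-TABLE ROW`664a1`, `(p, d_K, ℓ) = (5, -39, 29)`, ON PRINT-STANDARD INPUTS — no McCallum leaf,
no structure theorem, no twist point, no system (bit at ANY datum).** For `E = 664a1`, ANY imaginary
quadratic `K` with `d_K = -39`, any frame `(Dt, β, ι)` and ANY single Kolyvagin–Heegner datum `d` of
conductor `29`, granted the ONE Literature fact (γ) = `GrossLMS1991.prop37_2_frobeniusCongruence`
(Gross 1991 Prop. 3.7 (2), the Eichler–Shimura congruence for Heegner points; cite-only): IF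
`d.kolyvaginClass _ 1 ≠ 0` (the row's bit), THEN `corank_{ℤ_5} Ш(E)[5^∞] = 0`, `rank_ℤ E(ℚ) = 2`,
`rank_ℤ E^{(-39)}(ℚ) ≤ 1`, `E(ℚ)[5] = 0`, `Ш(E/ℚ)[5] = 0` and `#Sel^(5)(E/ℚ) = 5²` — the twin of
`C664a1.depthRow_5_neg39_29_ofDatum` with its FIVE named McCallum / Gross leaves (`h54 h43 h44 h53
h22`) DELETED: the sign law, Lemma 5.3 and Prop. 2.2 are tree theorems (`…LeafSign`,
`…LeafEigenLine`, `…LeafReciprocity`), Lemma 4.3 is proved on the Kodaira–Néron cell / taken from F1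
(`…LeafLocal`), Prop. 4.4 comes from (γ) (`JET.prop44_of_frobeniusCongruence`); the Kodaira–Néron
side condition (KN_5) `5 ∤ ord_v(Δ_min)` at the multiplicative places is CERTIFIED IN THE KERNEL
from `Δ(E₀) = -21248` (`decide`-able table of `depthRow_print_of_datum_of_intModel_certificate`),
the additive clause is void (`5 ≠ 3`). Every other side condition is a kernel theorem of the tree
(g2–g7 certificates). CONDITIONAL on (γ) and the bit; per-curve; BSD is not proved by it. [cite:
Kolyvagin1991MathAnn, Thm. 2.3] [cite: GrossLMS1991, Prop. 3.7 (2), §5 (5.1), Prop. 6.2 (1)] [cite: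
McCallumLMS1991, §§2–5] [cite: JetchevLauterStein2009, §3.6 (arXiv:0707.0032)] -/
theorem depthRow_5_neg39_29_print
    (h372 : GrossLMS1991.prop37_2_frobeniusCongruence)
    (K : Type) [Field K] [NumberField K] (hK : IsImaginaryQuadratic K)
    (hD : NumberField.discr K = -39) :
    haveI := isElliptic_c664a1;
    haveI := isGloballyMinimal_c664a1;
    haveI : NeZero (((⟨0, 0, 0, -7, 10⟩ : WeierstrassCurve ℤ).map (Int.castRingHom ℚ)).conductorNorm ℤ) :=
      neZero_conductorNorm_of_isElliptic _;
    ∀ (Dt : ModularParametrizationData ((⟨0, 0, 0, -7, 10⟩ : WeierstrassCurve ℤ).map (Int.castRingHom ℚ))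
        (((⟨0, 0, 0, -7, 10⟩ : WeierstrassCurve ℤ).map (Int.castRingHom ℚ)).conductorNorm ℤ)) (β : ℤ)
      (ι : K →+* ℂ) (d : KolyvaginHeegnerData Dt β ι 29),
    d.kolyvaginClass (p := 5) (by norm_num) 1 ≠ 0 →
    ((⟨0, 0, 0, -7, 10⟩ : WeierstrassCurve ℤ).map (Int.castRingHom ℚ)).shaCorank 5 = 0 ∧
      ((⟨0, 0, 0, -7, 10⟩ : WeierstrassCurve ℤ).map (Int.castRingHom ℚ)).mordellWeilRank = 2 ∧
      (((⟨0, 0, 0, -7, 10⟩ : WeierstrassCurve ℤ).map (Int.castRingHom ℚ)).quadraticTwist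
        ((-39 : ℤ) : ℚ)).mordellWeilRank ≤ 1 ∧
      (∀ P : ((⟨0, 0, 0, -7, 10⟩ : WeierstrassCurve ℤ).map (Int.castRingHom ℚ)).toAffine.Point,
        5 • P = 0 → P = 0) ∧
      (∀ x ∈ ((⟨0, 0, 0, -7, 10⟩ : WeierstrassCurve ℤ).map (Int.castRingHom ℚ)).sha, 5 • x = 0 → x = 0) ∧
      Nat.card ↥(selmerGroup ((⟨0, 0, 0, -7, 10⟩ : WeierstrassCurve ℤ).map (Int.castRingHom ℚ))
        ((5 : ℕ) : ℤ)) = 5 ^ 2 := by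
  haveI := isElliptic_c664a1
  haveI := isGloballyMinimal_c664a1
  haveI : NeZero (((⟨0, 0, 0, -7, 10⟩ : WeierstrassCurve ℤ).map (Int.castRingHom ℚ)).conductorNorm ℤ) :=
    neZero_conductorNorm_of_isElliptic _
  intro Dt β ι d hne
  haveI := Fact.mk (by norm_num : Nat.Prime 5)
  exact depthRow_print_of_datum_of_intModel_certificate intModel h372 not_hasCM
    KernelCerts001.C664a1.two_le_rank 5 (by norm_num) hasSurjectiveModNGaloisRep_pow_5 K hK hD
    (by norm_num) (by norm_num) heegner_neg39 29 (by norm_num) (by norm_num) (by decide +kernel)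
    (by norm_num) (by norm_num) (by norm_num) (by norm_num) (n := 25) card_29 (by norm_num)
    (Δ₀ := -21248) (by decide +kernel) (B := 11) (by decide +kernel) (by decide +kernel)
    (fun _ _ ↦ Or.inl (by norm_num)) Dt β ι d hne

end C664a1

namespace C916c1

/-- **DEPTH-TABLE ROW`916c1`, `(p, d_K, ℓ) = (5, -111, 19)`, ON PRINT-STANDARD INPUTS — no McCallum
leaf, no structure theorem, no twist point, no system (bit at ANY datum).** For `E = 916c1`, ANY
imaginary quadratic `K` with `d_K = -111`, any frame `(Dt, β, ι)` and ANY single Kolyvagin–Heegner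
datum `d` of conductor `19`, granted the ONE Literature fact (γ) =
`GrossLMS1991.prop37_2_frobeniusCongruence` (Gross 1991 Prop. 3.7 (2), the Eichler–Shimura
congruence for Heegner points; cite-only): IF `d.kolyvaginClass _ 1 ≠ 0` (the row's bit), THEN
`corank_{ℤ_5} Ш(E)[5^∞] = 0`, `rank_ℤ E(ℚ) = 2`, `rank_ℤ E^{(-111)}(ℚ) ≤ 1`, `E(ℚ)[5] = 0`,
`Ш(E/ℚ)[5] = 0` and `#Sel^(5)(E/ℚ) = 5²` — the twin of `C916c1.depthRow_5_neg111_19_ofDatum` with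
its FIVE named McCallum / Gross leaves (`h54 h43 h44 h53 h22`) DELETED: the sign law, Lemma 5.3 and
Prop. 2.2 are tree theorems (`…LeafSign`, `…LeafEigenLine`, `…LeafReciprocity`), Lemma 4.3 is proved
on the Kodaira–Néron cell / taken from F1 (`…LeafLocal`), Prop. 4.4 comes from (γ)
(`JET.prop44_of_frobeniusCongruence`); the Kodaira–Néron side condition (KN_5) `5 ∤ ord_v(Δ_min)` at
the multiplicative places is CERTIFIED IN THE KERNEL from `Δ(E₀) = 3664` (`decide`-able table of
`depthRow_print_of_datum_of_intModel_certificate`), the additive clause is void (`5 ≠ 3`). Every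
other side condition is a kernel theorem of the tree (g2–g7 certificates). CONDITIONAL on (γ) and
the bit; per-curve; BSD is not proved by it. [cite: Kolyvagin1991MathAnn, Thm. 2.3] [cite:
GrossLMS1991, Prop. 3.7 (2), §5 (5.1), Prop. 6.2 (1)] [cite: McCallumLMS1991, §§2–5] [cite:
JetchevLauterStein2009, §3.6 (arXiv:0707.0032)] -/
theorem depthRow_5_neg111_19_print
    (h372 : GrossLMS1991.prop37_2_frobeniusCongruence)
    (K : Type) [Field K] [NumberField K] (hK : IsImaginaryQuadratic K)
    (hD : NumberField.discr K = -111) :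
    haveI := isElliptic_c916c1;
    haveI := isGloballyMinimal_c916c1;
    haveI : NeZero (((⟨0, 0, 0, -4, 1⟩ : WeierstrassCurve ℤ).map (Int.castRingHom ℚ)).conductorNorm ℤ) :=
      neZero_conductorNorm_of_isElliptic _;
    ∀ (Dt : ModularParametrizationData ((⟨0, 0, 0, -4, 1⟩ : WeierstrassCurve ℤ).map (Int.castRingHom ℚ))
        (((⟨0, 0, 0, -4, 1⟩ : WeierstrassCurve ℤ).map (Int.castRingHom ℚ)).conductorNorm ℤ)) (β : ℤ)
      (ι : K →+* ℂ) (d : KolyvaginHeegnerData Dt β ι 19),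
    d.kolyvaginClass (p := 5) (by norm_num) 1 ≠ 0 →
    ((⟨0, 0, 0, -4, 1⟩ : WeierstrassCurve ℤ).map (Int.castRingHom ℚ)).shaCorank 5 = 0 ∧
      ((⟨0, 0, 0, -4, 1⟩ : WeierstrassCurve ℤ).map (Int.castRingHom ℚ)).mordellWeilRank = 2 ∧
      (((⟨0, 0, 0, -4, 1⟩ : WeierstrassCurve ℤ).map (Int.castRingHom ℚ)).quadraticTwist
        ((-111 : ℤ) : ℚ)).mordellWeilRank ≤ 1 ∧
      (∀ P : ((⟨0, 0, 0, -4, 1⟩ : WeierstrassCurve ℤ).map (Int.castRingHom ℚ)).toAffine.Point,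
        5 • P = 0 → P = 0) ∧
      (∀ x ∈ ((⟨0, 0, 0, -4, 1⟩ : WeierstrassCurve ℤ).map (Int.castRingHom ℚ)).sha, 5 • x = 0 → x = 0) ∧
      Nat.card ↥(selmerGroup ((⟨0, 0, 0, -4, 1⟩ : WeierstrassCurve ℤ).map (Int.castRingHom ℚ))
        ((5 : ℕ) : ℤ)) = 5 ^ 2 := by
  haveI := isElliptic_c916c1
  haveI := isGloballyMinimal_c916c1
  haveI : NeZero (((⟨0, 0, 0, -4, 1⟩ : WeierstrassCurve ℤ).map (Int.castRingHom ℚ)).conductorNorm ℤ) :=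
    neZero_conductorNorm_of_isElliptic _
  intro Dt β ι d hne
  haveI := Fact.mk (by norm_num : Nat.Prime 5)
  exact depthRow_print_of_datum_of_intModel_certificate intModel h372 not_hasCM
    KernelCerts002.C916c1.two_le_rank 5 (by norm_num) hasSurjectiveModNGaloisRep_pow_5 K hK hD
    (by norm_num) (by norm_num) heegner_neg111 19 (by norm_num) (by norm_num) (by decide +kernel)
    (by norm_num) (by norm_num) (by norm_num) (by norm_num) (n := 25) card_19 (by norm_num)
    (Δ₀ := 3664) (by decide +kernel) (B := 11) (by decide +kernel) (by decide +kernel)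
    (fun _ _ ↦ Or.inl (by norm_num)) Dt β ι d hne

end C916c1

namespace C944e1

/-- **DEPTH-TABLE ROW`944e1`, `(p, d_K, ℓ) = (5, -31, 239)`, ON PRINT-STANDARD INPUTS — no McCallum
leaf, no structure theorem, no twist point, no system (bit at ANY datum).** For `E = 944e1`, ANY
imaginary quadratic `K` with `d_K = -31`, any frame `(Dt, β, ι)` and ANY single Kolyvagin–Heegner
datum `d` of conductor `239`, granted the ONE Literature fact (γ) =
`GrossLMS1991.prop37_2_frobeniusCongruence` (Gross 1991 Prop. 3.7 (2), the Eichler–Shimura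
congruence for Heegner points; cite-only) and, this curve being OFF the Kodaira–Néron cell at `5`
(`ord_2 Δ = 10`, `2` additive), the Literature fact F1 =
`Gross1991_heegnerPoint_sub_ratTorsion_mem_E0` ([GZ86, III (3.1)]; cite-only): IF `d.kolyvaginClass
_ 1 ≠ 0` (the row's bit), THEN `corank_{ℤ_5} Ш(E)[5^∞] = 0`, `rank_ℤ E(ℚ) = 2`, `rank_ℤ E^{(-31)}(ℚ)
≤ 1`, `E(ℚ)[5] = 0`, `Ш(E/ℚ)[5] = 0` and `#Sel^(5)(E/ℚ) = 5²` — the twin of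
`C944e1.depthRow_5_neg31_239_ofDatum` with its FIVE named McCallum / Gross leaves (`h54 h43 h44 h53
h22`) DELETED: the sign law, Lemma 5.3 and Prop. 2.2 are tree theorems (`…LeafSign`,
`…LeafEigenLine`, `…LeafReciprocity`), Lemma 4.3 is proved on the Kodaira–Néron cell / taken from F1
(`…LeafLocal`), Prop. 4.4 comes from (γ) (`JET.prop44_of_frobeniusCongruence`); kit
`depthRow_print_of_datum_of_intModel_certificate_gross1991E0`. Every other side condition is a
kernel theorem of the tree (g2–g7 certificates). CONDITIONAL on (γ) + F1 and the bit; per-curve; BSD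
is not proved by it. [cite: Kolyvagin1991MathAnn, Thm. 2.3] [cite: GrossLMS1991, Prop. 3.7 (2), §5
(5.1), Prop. 6.2 (1)] [cite: McCallumLMS1991, §§2–5] [cite: JetchevLauterStein2009, §3.6
(arXiv:0707.0032)] -/
theorem depthRow_5_neg31_239_print
    (h372 : GrossLMS1991.prop37_2_frobeniusCongruence)
    (hE0 : Gross1991_heegnerPoint_sub_ratTorsion_mem_E0)
    (K : Type) [Field K] [NumberField K] (hK : IsImaginaryQuadratic K)
    (hD : NumberField.discr K = -31) :
    haveI := isElliptic_c944e1;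
    haveI := isGloballyMinimal_c944e1;
    haveI : NeZero (((⟨0, 0, 0, -19, 34⟩ : WeierstrassCurve ℤ).map (Int.castRingHom ℚ)).conductorNorm ℤ) :=
      neZero_conductorNorm_of_isElliptic _;
    ∀ (Dt : ModularParametrizationData ((⟨0, 0, 0, -19, 34⟩ : WeierstrassCurve ℤ).map (Int.castRingHom ℚ))
        (((⟨0, 0, 0, -19, 34⟩ : WeierstrassCurve ℤ).map (Int.castRingHom ℚ)).conductorNorm ℤ)) (β : ℤ)
      (ι : K →+* ℂ) (d : KolyvaginHeegnerData Dt β ι 239),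
    d.kolyvaginClass (p := 5) (by norm_num) 1 ≠ 0 →
    ((⟨0, 0, 0, -19, 34⟩ : WeierstrassCurve ℤ).map (Int.castRingHom ℚ)).shaCorank 5 = 0 ∧
      ((⟨0, 0, 0, -19, 34⟩ : WeierstrassCurve ℤ).map (Int.castRingHom ℚ)).mordellWeilRank = 2 ∧
      (((⟨0, 0, 0, -19, 34⟩ : WeierstrassCurve ℤ).map (Int.castRingHom ℚ)).quadraticTwist
        ((-31 : ℤ) : ℚ)).mordellWeilRank ≤ 1 ∧
      (∀ P : ((⟨0, 0, 0, -19, 34⟩ : WeierstrassCurve ℤ).map (Int.castRingHom ℚ)).toAffine.Point,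
        5 • P = 0 → P = 0) ∧
      (∀ x ∈ ((⟨0, 0, 0, -19, 34⟩ : WeierstrassCurve ℤ).map (Int.castRingHom ℚ)).sha, 5 • x = 0 → x = 0) ∧
      Nat.card ↥(selmerGroup ((⟨0, 0, 0, -19, 34⟩ : WeierstrassCurve ℤ).map (Int.castRingHom ℚ))
        ((5 : ℕ) : ℤ)) = 5 ^ 2 := by
  haveI := isElliptic_c944e1
  haveI := isGloballyMinimal_c944e1
  haveI : NeZero (((⟨0, 0, 0, -19, 34⟩ : WeierstrassCurve ℤ).map (Int.castRingHom ℚ)).conductorNorm ℤ) :=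
    neZero_conductorNorm_of_isElliptic _
  intro Dt β ι d hne
  haveI := Fact.mk (by norm_num : Nat.Prime 5)
  exact depthRow_print_of_datum_of_intModel_certificate_gross1991E0 intModel h372 hE0 not_hasCM
    KernelCerts002.C944e1.two_le_rank 5 (by norm_num) hasSurjectiveModNGaloisRep_pow_5 K hK hD
    (by norm_num) (by norm_num) heegner_neg31 239 (by norm_num) (by norm_num) (by decide +kernel)
    (by norm_num) (by norm_num) (by norm_num) (by norm_num) (n := 255) card_239 (by norm_num) Dt β ι
    d hne

end C944e1

end Summit.BirchSwinnertonDyer.BirchSwinnertonDyer.Theorems.KolyvaginDepthDoor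

end
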